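import Literature.IUT.HodgeTheaters.GlobalFrobenioidsArithmeticBaseOnEquivalences
import HarnessLib

/-!
# [IUTchI] Example 5.1 (ii)/(iii): [FrdI] Thm 5.2 / Cor 4.11 for the arithmetic divisor data WHISKERED along any
# `S : ℬ(H)⁰ ⥤ FinSubextCat F F̄` — the model Frobenioid of `(Φ ∘ S, 𝔹 ∘ S, Div ∘ S)` over `ℬ(H)⁰`, `H` slim
# (the [FrdI] Prop 1.6 base-changed model of `†ℱ^⊚ := †ℱ^⊛|_{†𝒟^⊚}`)

S. Mochizuki, *Inter-universal Teichmüller theory I*, kurims manuscript (May 2020), §5, Example 5.1 (ii) p. 125 («the monoid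
of arithmetic divisors on the corresponding subfield»), (iii) pp. 125–126 («`†ℱ^⊚ := †ℱ^⊛|_{†𝒟^⊚}`»), Cor 5.3 (i) p. 144
(«respectively, `⊚`») ([IUTchI] Ex 5.1 (iii) p.126) [claim: Mochizuki2012, status: disputed]; S. Mochizuki, *The geometry of
Frobenioids I*, Kyushu J. Math. **62** (2008), Prop 1.6 p. 27 (base change `C ×_D D′`, divisor monoid «the restriction of `Φ` to
`D′`»), Thm 5.2 p. 100, Cor 4.11 (ii)/(iv) pp. 91–92, Ex 6.3 p. 113 [cite: MochizukiFrdI2008, Prop. 1.6 p.27] [cite: MochizukiFrdI2008, Cor. 4.11 p.91].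

PROOF-ONLY (theorems only; cell abc-iut, seat abc-iut-L5-t11 gen 16, row «C53I-FCIRC-HKER» file F1, abc-iut-L5-lead RULINGS #154
(2b)).  abc-iut-w4-d109's `GlobalFrobenioidsArithmeticCor411[GF]` proved the [FrdI] Cor 4.11 package for the arithmetic model
`arith F` (`S = galoisSubextOfFinite F` over `ℬ(G_F)⁰`) and for `arithAlong F ρ hρ` (`S = subfieldFunctor ρ` over `ℬ(G)⁰`).  The
`⊚` carrier of [IUTchI] Cor 5.3 (i) — abc-iut-L5-t4's `𝓕.Fcirc`, the categorical fibre product of `ℱ^⊛(†𝒟^⊚) → ℬ(G_F)⁰` along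
`T : †𝒟^⊚ = ℬ(H)⁰ → ℬ(G_F)⁰` — is equivalent ([FrdI] §0 / Prop 1.6; abc-iut-f-027's
`ModelFrobenioid.exists_restrict_equivalence_fiberProduct`) to the model Frobenioid of the WHISKERED data, i.e. to the case
`S = T ⋙ galoisSubextOfFinite F`.  This file proves the SAME package once for EVERY `S : ℬ(H)⁰ ⥤ FinSubextCat F F̄`, `H` slim,
from abc-iut-w4-d109's §Composite lemmas and abc-iut-L5-t1's/abc-iut-w4-d050's model lemmas — nothing but instantiation:
the [FrdI] Thm 5.2 hypotheses (`hypotheses_whisker`; `Φ ∘ S` is a monoid on the FSM-type category `ℬ(H)⁰` for ANY `S`,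
`isMonoidOn_comp_of_isOfFSMType`), «is a Frobenioid», standard type, not group-like, perf-factorial, rational at THE
birationalization, `Cor411Setting`, the `1`-unique base square with rigid composites, «`Ψ` preserves `deg_Fr`», the Cor 4.11 (iv)
consumer data `(Ψ^Base, Ψ^Φ, η)` with the divisor formula, and `HasUnder`/`UnderUnique` for the base functor.  Consumed by this
seat's `Cor53iFcircHkerOfMonoidRigidity` (file F2).  No definitions, no new Prop facts; nothing here bears on [IUTchIII] Cor. 3.12
or asserts anything about abc.
-/

noncomputable section

-- `(PreFrobenioidData.ofFunctor Φ F).base` / `ModelFrobenioid.data` unfold only at default transparency.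
set_option backward.isDefEq.respectTransparency false

namespace Literature.IUT.HodgeTheaters

open CategoryTheory Opposite NumberField
open Literature.AlgebraicGeometry.Frobenioids Literature.AnabelianGeometry.SemiGraphs
open Literature.AlgebraicGeometry.Frobenioids.QuasiTemperoid
open Literature.AlgebraicGeometry.Frobenioids.PreFrobenioid

namespace GlobalDivisorData

/-! ### §1. One whiskered datum: [FrdI] Thm 5.2 hypotheses, «is a Frobenioid», standard type -/

section One

variable {H : ProfiniteGrp.{0}} (F : Type) [Field F] [NumberField F] (S : BaseCat H ⥤ FinSubextCat F (Fbar F))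

/-- **[FrdI] Thm 5.2 standing hypotheses for the whiskered data `(Φ ∘ S, 𝔹 ∘ S)` over `ℬ(H)⁰`**: `Φ ∘ S`, `𝔹 ∘ S` are monoids on
the FSM-type category `ℬ(H)⁰` for ANY `S` (`isMonoidOn_comp_of_isOfFSMType`), divisorial / group-like objectwise, `ℬ(H)⁰` connected
and totally epimorphic. ([IUTchI] Ex 5.1 (ii) p.125) [cite: MochizukiFrdI2008, Thm. 5.2 p.100] [claim: Mochizuki2012, status: disputed] -/
theorem hypotheses_whisker : ModelFrobenioid.Hypotheses (GlobalDivisorData.mk (S.op ⋙ arithDivisorFunctor F (Fbar F)) (S.op ⋙ unitsFunctor F (Fbar F))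
        (Functor.whiskerLeft S.op (divNatTrans F (Fbar F))) : GlobalDivisorData H).Φ (GlobalDivisorData.mk (S.op ⋙ arithDivisorFunctor F (Fbar F)) (S.op ⋙ unitsFunctor F (Fbar F))
        (Functor.whiskerLeft S.op (divNatTrans F (Fbar F))) : GlobalDivisorData H).B := by
  haveI : IsGalois F (Fbar F) := isGalois_fbar F
  exact
    { isMonoidOn := isMonoidOn_comp_of_isOfFSMType S (isOfFSMType_baseCat H) (arithDivisorFunctor_isMonoidOn F (Fbar F))
      isDivisorial := objectwise_comp S (arithDivisorFunctor_isDivisorial F (Fbar F))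
      isMonoidOn_rat := isMonoidOn_comp_of_isOfFSMType S (isOfFSMType_baseCat H) (unitsFunctor_isMonoidOn F (Fbar F))
      isGroupLike_rat := objectwise_comp S (unitsFunctor_isGroupLike F (Fbar F))
      isGraphConnected := isGraphConnected_baseCat H
      isTotallyEpimorphic := isTotallyEpimorphic_baseCat H }

/-- **«`ℱ^⊛(†𝒟^⊚)` … a model Frobenioid» for the whiskered data — IS a Frobenioid** ([FrdI] Thm 5.2 (ii), abc-iut-w4-d050's
`isFrobenioid_model`). ([IUTchI] Ex 5.1 (ii) p.125) [claim: Mochizuki2012, status: disputed] -/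
theorem isFrobenioid_whisker : PreFrobenioid.IsFrobenioid (ModelFrobenioid.toElem (GlobalDivisorData.mk (S.op ⋙ arithDivisorFunctor F (Fbar F)) (S.op ⋙ unitsFunctor F (Fbar F))
        (Functor.whiskerLeft S.op (divNatTrans F (Fbar F))) : GlobalDivisorData H).Φ (GlobalDivisorData.mk (S.op ⋙ arithDivisorFunctor F (Fbar F)) (S.op ⋙ unitsFunctor F (Fbar F))
        (Functor.whiskerLeft S.op (divNatTrans F (Fbar F))) : GlobalDivisorData H).B (GlobalDivisorData.mk (S.op ⋙ arithDivisorFunctor F (Fbar F)) (S.op ⋙ unitsFunctor F (Fbar F))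
        (Functor.whiskerLeft S.op (divNatTrans F (Fbar F))) : GlobalDivisorData H).div) :=
  ((GlobalDivisorData.mk (S.op ⋙ arithDivisorFunctor F (Fbar F)) (S.op ⋙ unitsFunctor F (Fbar F))
        (Functor.whiskerLeft S.op (divNatTrans F (Fbar F))) : GlobalDivisorData H)).isFrobenioid_model (hypotheses_whisker F S).isMonoidOn (hypotheses_whisker F S).isDivisorial
    (hypotheses_whisker F S).isMonoidOn_rat (hypotheses_whisker F S).isGroupLike_rat

/-- The whiskered model is of STANDARD TYPE ([FrdI] Thm 6.4 (i); abc-iut-w4-d109 `isOfStandardType_model_arith_comp`).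
([IUTchI] Ex 5.1 (ii) p.125) [claim: Mochizuki2012, status: disputed] -/
theorem isOfStandardType_whisker : (ModelFrobenioid.data (GlobalDivisorData.mk (S.op ⋙ arithDivisorFunctor F (Fbar F)) (S.op ⋙ unitsFunctor F (Fbar F))
        (Functor.whiskerLeft S.op (divNatTrans F (Fbar F))) : GlobalDivisorData H).Φ (GlobalDivisorData.mk (S.op ⋙ arithDivisorFunctor F (Fbar F)) (S.op ⋙ unitsFunctor F (Fbar F))
        (Functor.whiskerLeft S.op (divNatTrans F (Fbar F))) : GlobalDivisorData H).B (GlobalDivisorData.mk (S.op ⋙ arithDivisorFunctor F (Fbar F)) (S.op ⋙ unitsFunctor F (Fbar F))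
        (Functor.whiskerLeft S.op (divNatTrans F (Fbar F))) : GlobalDivisorData H).div).IsOfStandardType := by
  haveI : Nonempty (BaseCat H) := (isGraphConnected_baseCat H).nonempty
  exact isOfStandardType_model_arith_comp S (isTotallyEpimorphic_baseCat H) (isOfFSMType_baseCat H)

/-- The whiskered model is NOT of group-like type. ([IUTchI] Ex 5.1 (ii) p.125) [claim: Mochizuki2012, status: disputed] -/
theorem not_isOfGroupLikeType_whisker : ¬ (ModelFrobenioid.data (GlobalDivisorData.mk (S.op ⋙ arithDivisorFunctor F (Fbar F)) (S.op ⋙ unitsFunctor F (Fbar F))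
        (Functor.whiskerLeft S.op (divNatTrans F (Fbar F))) : GlobalDivisorData H).Φ (GlobalDivisorData.mk (S.op ⋙ arithDivisorFunctor F (Fbar F)) (S.op ⋙ unitsFunctor F (Fbar F))
        (Functor.whiskerLeft S.op (divNatTrans F (Fbar F))) : GlobalDivisorData H).B (GlobalDivisorData.mk (S.op ⋙ arithDivisorFunctor F (Fbar F)) (S.op ⋙ unitsFunctor F (Fbar F))
        (Functor.whiskerLeft S.op (divNatTrans F (Fbar F))) : GlobalDivisorData H).div).IsOfGroupLikeType := by
  haveI : Nonempty (BaseCat H) := (isGraphConnected_baseCat H).nonempty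
  exact not_isOfGroupLikeType_model_arith_comp S

/-- `Φ ∘ S` is perf-factorial objectwise. ([IUTchI] Ex 5.1 (ii) p.125) [claim: Mochizuki2012, status: disputed] -/
theorem objectwise_isPerfFactorial_whisker : Objectwise (fun M _ => IsPerfFactorial M) (GlobalDivisorData.mk (S.op ⋙ arithDivisorFunctor F (Fbar F)) (S.op ⋙ unitsFunctor F (Fbar F))
        (Functor.whiskerLeft S.op (divNatTrans F (Fbar F))) : GlobalDivisorData H).Φ :=
  objectwise_isPerfFactorial_arithDivisorFunctor_comp S

/-- Every object of the whiskered model is RATIONAL at THE birationalization. ([IUTchI] Ex 5.1 (ii) p.125) [claim: Mochizuki2012, status: disputed] -/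
theorem isRational_biratData_whisker (A : (GlobalDivisorData.mk (S.op ⋙ arithDivisorFunctor F (Fbar F)) (S.op ⋙ unitsFunctor F (Fbar F))
        (Functor.whiskerLeft S.op (divNatTrans F (Fbar F))) : GlobalDivisorData H).ModelGlobalFrobenioid) :
    PreFrobenioidData.IsRational
      (biratData (isFrobenioid_whisker F S) (hasBiratSquares_of_isFrobenioid (isFrobenioid_whisker F S)))
      (S := (ModelFrobenioid.data (GlobalDivisorData.mk (S.op ⋙ arithDivisorFunctor F (Fbar F)) (S.op ⋙ unitsFunctor F (Fbar F))
        (Functor.whiskerLeft S.op (divNatTrans F (Fbar F))) : GlobalDivisorData H).Φ (GlobalDivisorData.mk (S.op ⋙ arithDivisorFunctor F (Fbar F)) (S.op ⋙ unitsFunctor F (Fbar F))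
        (Functor.whiskerLeft S.op (divNatTrans F (Fbar F))) : GlobalDivisorData H).B (GlobalDivisorData.mk (S.op ⋙ arithDivisorFunctor F (Fbar F)) (S.op ⋙ unitsFunctor F (Fbar F))
        (Functor.whiskerLeft S.op (divNatTrans F (Fbar F))) : GlobalDivisorData H).div)) (fun a 𝔭 => PrimarySupp a 𝔭) A :=
  isRational_biratData_model_arith_comp S (isFrobenioid_whisker F S) A

end One

/-! ### §2. Two whiskered data: [FrdI] Cor 4.11 (ii)/(iv) for every `Ψ`, `H₁ H₂` slim -/

section Two

variable (F : Type) [Field F] [NumberField F]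
  {H₁ : ProfiniteGrp.{0}} (S₁ : BaseCat H₁ ⥤ FinSubextCat F (Fbar F))
  {H₂ : ProfiniteGrp.{0}} (S₂ : BaseCat H₂ ⥤ FinSubextCat F (Fbar F))

/-- **[FrdI] Cor 4.11 (ii) AS TYPED for every `Ψ` between two whiskered models** (abc-iut-L1-d6's `FrdI.cor411ii_ofFunctor`).
([IUTchI] Ex 5.1 (iii) p.126) [cite: MochizukiFrdI2008, Cor. 4.11 (ii) p.91] [claim: Mochizuki2012, status: disputed] -/
theorem cor411ii_whisker (Ψ : (GlobalDivisorData.mk (S₁.op ⋙ arithDivisorFunctor F (Fbar F)) (S₁.op ⋙ unitsFunctor F (Fbar F))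
        (Functor.whiskerLeft S₁.op (divNatTrans F (Fbar F))) : GlobalDivisorData H₁).ModelGlobalFrobenioid ≌ (GlobalDivisorData.mk (S₂.op ⋙ arithDivisorFunctor F (Fbar F)) (S₂.op ⋙ unitsFunctor F (Fbar F))
        (Functor.whiskerLeft S₂.op (divNatTrans F (Fbar F))) : GlobalDivisorData H₂).ModelGlobalFrobenioid) :
    (ModelFrobenioid.data (GlobalDivisorData.mk (S₁.op ⋙ arithDivisorFunctor F (Fbar F)) (S₁.op ⋙ unitsFunctor F (Fbar F))
        (Functor.whiskerLeft S₁.op (divNatTrans F (Fbar F))) : GlobalDivisorData H₁).Φ (GlobalDivisorData.mk (S₁.op ⋙ arithDivisorFunctor F (Fbar F)) (S₁.op ⋙ unitsFunctor F (Fbar F))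
        (Functor.whiskerLeft S₁.op (divNatTrans F (Fbar F))) : GlobalDivisorData H₁).B (GlobalDivisorData.mk (S₁.op ⋙ arithDivisorFunctor F (Fbar F)) (S₁.op ⋙ unitsFunctor F (Fbar F))
        (Functor.whiskerLeft S₁.op (divNatTrans F (Fbar F))) : GlobalDivisorData H₁).div).Cor411ii (ModelFrobenioid.data (GlobalDivisorData.mk (S₂.op ⋙ arithDivisorFunctor F (Fbar F)) (S₂.op ⋙ unitsFunctor F (Fbar F))
        (Functor.whiskerLeft S₂.op (divNatTrans F (Fbar F))) : GlobalDivisorData H₂).Φ (GlobalDivisorData.mk (S₂.op ⋙ arithDivisorFunctor F (Fbar F)) (S₂.op ⋙ unitsFunctor F (Fbar F))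
        (Functor.whiskerLeft S₂.op (divNatTrans F (Fbar F))) : GlobalDivisorData H₂).B (GlobalDivisorData.mk (S₂.op ⋙ arithDivisorFunctor F (Fbar F)) (S₂.op ⋙ unitsFunctor F (Fbar F))
        (Functor.whiskerLeft S₂.op (divNatTrans F (Fbar F))) : GlobalDivisorData H₂).div) Ψ :=
  FrdI.cor411ii_ofFunctor (isFrobenioid_whisker F S₁) (isFrobenioid_whisker F S₂) Ψ
    (objectwise_isPerfFactorial_whisker F S₁) (objectwise_isPerfFactorial_whisker F S₂)

/-- **`Cor411Setting` for every such `Ψ`, modulo the slimness of `H₁, H₂`.** ([IUTchI] Ex 5.1 (iii) p.126) [claim: Mochizuki2012, status: disputed] -/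
theorem cor411Setting_whisker (hZ₁ : IsSlimGroup H₁) (hZ₂ : IsSlimGroup H₂)
    (Ψ : (GlobalDivisorData.mk (S₁.op ⋙ arithDivisorFunctor F (Fbar F)) (S₁.op ⋙ unitsFunctor F (Fbar F))
        (Functor.whiskerLeft S₁.op (divNatTrans F (Fbar F))) : GlobalDivisorData H₁).ModelGlobalFrobenioid ≌ (GlobalDivisorData.mk (S₂.op ⋙ arithDivisorFunctor F (Fbar F)) (S₂.op ⋙ unitsFunctor F (Fbar F))
        (Functor.whiskerLeft S₂.op (divNatTrans F (Fbar F))) : GlobalDivisorData H₂).ModelGlobalFrobenioid) :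
    (ModelFrobenioid.data (GlobalDivisorData.mk (S₁.op ⋙ arithDivisorFunctor F (Fbar F)) (S₁.op ⋙ unitsFunctor F (Fbar F))
        (Functor.whiskerLeft S₁.op (divNatTrans F (Fbar F))) : GlobalDivisorData H₁).Φ (GlobalDivisorData.mk (S₁.op ⋙ arithDivisorFunctor F (Fbar F)) (S₁.op ⋙ unitsFunctor F (Fbar F))
        (Functor.whiskerLeft S₁.op (divNatTrans F (Fbar F))) : GlobalDivisorData H₁).B (GlobalDivisorData.mk (S₁.op ⋙ arithDivisorFunctor F (Fbar F)) (S₁.op ⋙ unitsFunctor F (Fbar F))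
        (Functor.whiskerLeft S₁.op (divNatTrans F (Fbar F))) : GlobalDivisorData H₁).div).Cor411Setting (ModelFrobenioid.data (GlobalDivisorData.mk (S₂.op ⋙ arithDivisorFunctor F (Fbar F)) (S₂.op ⋙ unitsFunctor F (Fbar F))
        (Functor.whiskerLeft S₂.op (divNatTrans F (Fbar F))) : GlobalDivisorData H₂).Φ (GlobalDivisorData.mk (S₂.op ⋙ arithDivisorFunctor F (Fbar F)) (S₂.op ⋙ unitsFunctor F (Fbar F))
        (Functor.whiskerLeft S₂.op (divNatTrans F (Fbar F))) : GlobalDivisorData H₂).B (GlobalDivisorData.mk (S₂.op ⋙ arithDivisorFunctor F (Fbar F)) (S₂.op ⋙ unitsFunctor F (Fbar F))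
        (Functor.whiskerLeft S₂.op (divNatTrans F (Fbar F))) : GlobalDivisorData H₂).div) Ψ where
  divSlim := ⟨PreFrobenioidData.isDivSlim_of_isSlim _ (isSlim_baseCat_of_isSlimGroup H₁ hZ₁),
    PreFrobenioidData.isDivSlim_of_isSlim _ (isSlim_baseCat_of_isSlimGroup H₂ hZ₂)⟩
  standard := ⟨isOfStandardType_whisker F S₁, isOfStandardType_whisker F S₂⟩
  hypB h₁ _ := absurd h₁ (not_isOfGroupLikeType_whisker F S₁)

/-- **The `1`-unique `Ψ^Base : ℬ(H₁)⁰ ⥲ ℬ(H₂)⁰` with rigid composites**, for slim `H₁, H₂`. ([IUTchI] Ex 5.1 (iii) p.126) [claim: Mochizuki2012, status: disputed] -/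
theorem exists_oneUniqueSquare_base_whisker (hZ₁ : IsSlimGroup H₁) (hZ₂ : IsSlimGroup H₂)
    (Ψ : (GlobalDivisorData.mk (S₁.op ⋙ arithDivisorFunctor F (Fbar F)) (S₁.op ⋙ unitsFunctor F (Fbar F))
        (Functor.whiskerLeft S₁.op (divNatTrans F (Fbar F))) : GlobalDivisorData H₁).ModelGlobalFrobenioid ≌ (GlobalDivisorData.mk (S₂.op ⋙ arithDivisorFunctor F (Fbar F)) (S₂.op ⋙ unitsFunctor F (Fbar F))
        (Functor.whiskerLeft S₂.op (divNatTrans F (Fbar F))) : GlobalDivisorData H₂).ModelGlobalFrobenioid) :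
    ∃ ΨBase : BaseCat H₁ ⥤ BaseCat H₂,
      PreFrobenioidData.OneUniqueSquare Ψ.functor (GlobalDivisorData.mk (S₁.op ⋙ arithDivisorFunctor F (Fbar F)) (S₁.op ⋙ unitsFunctor F (Fbar F))
        (Functor.whiskerLeft S₁.op (divNatTrans F (Fbar F))) : GlobalDivisorData H₁).modelBase (GlobalDivisorData.mk (S₂.op ⋙ arithDivisorFunctor F (Fbar F)) (S₂.op ⋙ unitsFunctor F (Fbar F))
        (Functor.whiskerLeft S₂.op (divNatTrans F (Fbar F))) : GlobalDivisorData H₂).modelBase ΨBase ∧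
        IsRigidFunctor (Ψ.functor ⋙ (GlobalDivisorData.mk (S₂.op ⋙ arithDivisorFunctor F (Fbar F)) (S₂.op ⋙ unitsFunctor F (Fbar F))
        (Functor.whiskerLeft S₂.op (divNatTrans F (Fbar F))) : GlobalDivisorData H₂).modelBase) ∧ IsRigidFunctor ((GlobalDivisorData.mk (S₁.op ⋙ arithDivisorFunctor F (Fbar F)) (S₁.op ⋙ unitsFunctor F (Fbar F))
        (Functor.whiskerLeft S₁.op (divNatTrans F (Fbar F))) : GlobalDivisorData H₁).modelBase ⋙ ΨBase) := by
  obtain ⟨ΨBase, hsq, hrig⟩ := cor411ii_whisker F S₁ S₂ Ψ (cor411Setting_whisker F S₁ S₂ hZ₁ hZ₂ Ψ)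
  exact ⟨ΨBase, hsq, hrig (isSlim_baseCat_of_isSlimGroup H₁ hZ₁) (isSlim_baseCat_of_isSlimGroup H₂ hZ₂)⟩

/-- **«`Ψ` preserves Frobenius degrees»** ([FrdI] Cor 4.11 (iii)), for slim `H₁, H₂`. ([IUTchI] Ex 5.1 (iii) p.126) [claim: Mochizuki2012, status: disputed] -/
theorem preservesDegFr_whisker (hZ₁ : IsSlimGroup H₁) (hZ₂ : IsSlimGroup H₂)
    (Ψ : (GlobalDivisorData.mk (S₁.op ⋙ arithDivisorFunctor F (Fbar F)) (S₁.op ⋙ unitsFunctor F (Fbar F))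
        (Functor.whiskerLeft S₁.op (divNatTrans F (Fbar F))) : GlobalDivisorData H₁).ModelGlobalFrobenioid ≌ (GlobalDivisorData.mk (S₂.op ⋙ arithDivisorFunctor F (Fbar F)) (S₂.op ⋙ unitsFunctor F (Fbar F))
        (Functor.whiskerLeft S₂.op (divNatTrans F (Fbar F))) : GlobalDivisorData H₂).ModelGlobalFrobenioid) :
    PreFrobenioidData.PreservesDegFr (ModelFrobenioid.data (GlobalDivisorData.mk (S₁.op ⋙ arithDivisorFunctor F (Fbar F)) (S₁.op ⋙ unitsFunctor F (Fbar F))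
        (Functor.whiskerLeft S₁.op (divNatTrans F (Fbar F))) : GlobalDivisorData H₁).Φ (GlobalDivisorData.mk (S₁.op ⋙ arithDivisorFunctor F (Fbar F)) (S₁.op ⋙ unitsFunctor F (Fbar F))
        (Functor.whiskerLeft S₁.op (divNatTrans F (Fbar F))) : GlobalDivisorData H₁).B (GlobalDivisorData.mk (S₁.op ⋙ arithDivisorFunctor F (Fbar F)) (S₁.op ⋙ unitsFunctor F (Fbar F))
        (Functor.whiskerLeft S₁.op (divNatTrans F (Fbar F))) : GlobalDivisorData H₁).div) (ModelFrobenioid.data (GlobalDivisorData.mk (S₂.op ⋙ arithDivisorFunctor F (Fbar F)) (S₂.op ⋙ unitsFunctor F (Fbar F))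
        (Functor.whiskerLeft S₂.op (divNatTrans F (Fbar F))) : GlobalDivisorData H₂).Φ (GlobalDivisorData.mk (S₂.op ⋙ arithDivisorFunctor F (Fbar F)) (S₂.op ⋙ unitsFunctor F (Fbar F))
        (Functor.whiskerLeft S₂.op (divNatTrans F (Fbar F))) : GlobalDivisorData H₂).B (GlobalDivisorData.mk (S₂.op ⋙ arithDivisorFunctor F (Fbar F)) (S₂.op ⋙ unitsFunctor F (Fbar F))
        (Functor.whiskerLeft S₂.op (divNatTrans F (Fbar F))) : GlobalDivisorData H₂).div) Ψ :=
  FrdI.preservesDegFr_of_cor411Setting (isFrobenioid_whisker F S₁) (isFrobenioid_whisker F S₂) Ψ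
    (cor411Setting_whisker F S₁ S₂ hZ₁ hZ₂ Ψ)

/-- **[FrdI] Cor 4.11 (iv), the consumer data `(Ψ^Base, Ψ^Φ, η)` with the divisor formula**, for slim `H₁, H₂`.
([IUTchI] Ex 5.1 (iii) p.126) [cite: MochizukiFrdI2008, Cor. 4.11 (iv) p.92] [claim: Mochizuki2012, status: disputed] -/
theorem exists_cor411iv_data_whisker (hZ₁ : IsSlimGroup H₁) (hZ₂ : IsSlimGroup H₂)
    (Ψ : (GlobalDivisorData.mk (S₁.op ⋙ arithDivisorFunctor F (Fbar F)) (S₁.op ⋙ unitsFunctor F (Fbar F))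
        (Functor.whiskerLeft S₁.op (divNatTrans F (Fbar F))) : GlobalDivisorData H₁).ModelGlobalFrobenioid ≌ (GlobalDivisorData.mk (S₂.op ⋙ arithDivisorFunctor F (Fbar F)) (S₂.op ⋙ unitsFunctor F (Fbar F))
        (Functor.whiskerLeft S₂.op (divNatTrans F (Fbar F))) : GlobalDivisorData H₂).ModelGlobalFrobenioid) :
    ∃ (ΨBase : BaseCat H₁ ⥤ BaseCat H₂)
      (E' : (ModelFrobenioid.data (GlobalDivisorData.mk (S₁.op ⋙ arithDivisorFunctor F (Fbar F)) (S₁.op ⋙ unitsFunctor F (Fbar F))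
        (Functor.whiskerLeft S₁.op (divNatTrans F (Fbar F))) : GlobalDivisorData H₁).Φ (GlobalDivisorData.mk (S₁.op ⋙ arithDivisorFunctor F (Fbar F)) (S₁.op ⋙ unitsFunctor F (Fbar F))
        (Functor.whiskerLeft S₁.op (divNatTrans F (Fbar F))) : GlobalDivisorData H₁).B (GlobalDivisorData.mk (S₁.op ⋙ arithDivisorFunctor F (Fbar F)) (S₁.op ⋙ unitsFunctor F (Fbar F))
        (Functor.whiskerLeft S₁.op (divNatTrans F (Fbar F))) : GlobalDivisorData H₁).div).DivisorMonoidIsoOverBase (ModelFrobenioid.data (GlobalDivisorData.mk (S₂.op ⋙ arithDivisorFunctor F (Fbar F)) (S₂.op ⋙ unitsFunctor F (Fbar F))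
        (Functor.whiskerLeft S₂.op (divNatTrans F (Fbar F))) : GlobalDivisorData H₂).Φ (GlobalDivisorData.mk (S₂.op ⋙ arithDivisorFunctor F (Fbar F)) (S₂.op ⋙ unitsFunctor F (Fbar F))
        (Functor.whiskerLeft S₂.op (divNatTrans F (Fbar F))) : GlobalDivisorData H₂).B (GlobalDivisorData.mk (S₂.op ⋙ arithDivisorFunctor F (Fbar F)) (S₂.op ⋙ unitsFunctor F (Fbar F))
        (Functor.whiskerLeft S₂.op (divNatTrans F (Fbar F))) : GlobalDivisorData H₂).div) ΨBase)
      (η : Ψ.functor ⋙ (GlobalDivisorData.mk (S₂.op ⋙ arithDivisorFunctor F (Fbar F)) (S₂.op ⋙ unitsFunctor F (Fbar F))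
        (Functor.whiskerLeft S₂.op (divNatTrans F (Fbar F))) : GlobalDivisorData H₂).modelBase ≅ (GlobalDivisorData.mk (S₁.op ⋙ arithDivisorFunctor F (Fbar F)) (S₁.op ⋙ unitsFunctor F (Fbar F))
        (Functor.whiskerLeft S₁.op (divNatTrans F (Fbar F))) : GlobalDivisorData H₁).modelBase ⋙ ΨBase),
      PreFrobenioidData.OneUniqueSquare Ψ.functor (GlobalDivisorData.mk (S₁.op ⋙ arithDivisorFunctor F (Fbar F)) (S₁.op ⋙ unitsFunctor F (Fbar F))
        (Functor.whiskerLeft S₁.op (divNatTrans F (Fbar F))) : GlobalDivisorData H₁).modelBase (GlobalDivisorData.mk (S₂.op ⋙ arithDivisorFunctor F (Fbar F)) (S₂.op ⋙ unitsFunctor F (Fbar F))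
        (Functor.whiskerLeft S₂.op (divNatTrans F (Fbar F))) : GlobalDivisorData H₂).modelBase ΨBase ∧
      PreFrobenioidData.PreservesDegFr (ModelFrobenioid.data (GlobalDivisorData.mk (S₁.op ⋙ arithDivisorFunctor F (Fbar F)) (S₁.op ⋙ unitsFunctor F (Fbar F))
        (Functor.whiskerLeft S₁.op (divNatTrans F (Fbar F))) : GlobalDivisorData H₁).Φ (GlobalDivisorData.mk (S₁.op ⋙ arithDivisorFunctor F (Fbar F)) (S₁.op ⋙ unitsFunctor F (Fbar F))
        (Functor.whiskerLeft S₁.op (divNatTrans F (Fbar F))) : GlobalDivisorData H₁).B (GlobalDivisorData.mk (S₁.op ⋙ arithDivisorFunctor F (Fbar F)) (S₁.op ⋙ unitsFunctor F (Fbar F))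
        (Functor.whiskerLeft S₁.op (divNatTrans F (Fbar F))) : GlobalDivisorData H₁).div) (ModelFrobenioid.data (GlobalDivisorData.mk (S₂.op ⋙ arithDivisorFunctor F (Fbar F)) (S₂.op ⋙ unitsFunctor F (Fbar F))
        (Functor.whiskerLeft S₂.op (divNatTrans F (Fbar F))) : GlobalDivisorData H₂).Φ (GlobalDivisorData.mk (S₂.op ⋙ arithDivisorFunctor F (Fbar F)) (S₂.op ⋙ unitsFunctor F (Fbar F))
        (Functor.whiskerLeft S₂.op (divNatTrans F (Fbar F))) : GlobalDivisorData H₂).B (GlobalDivisorData.mk (S₂.op ⋙ arithDivisorFunctor F (Fbar F)) (S₂.op ⋙ unitsFunctor F (Fbar F))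
        (Functor.whiskerLeft S₂.op (divNatTrans F (Fbar F))) : GlobalDivisorData H₂).div) Ψ ∧
      (∀ ⦃A B : (GlobalDivisorData.mk (S₁.op ⋙ arithDivisorFunctor F (Fbar F)) (S₁.op ⋙ unitsFunctor F (Fbar F))
        (Functor.whiskerLeft S₁.op (divNatTrans F (Fbar F))) : GlobalDivisorData H₁).ModelGlobalFrobenioid⦄ (φ : A ⟶ B),
        ModelFrobenioid.div (Ψ.functor.map φ) =
          Literature.AlgebraicGeometry.Frobenioids.pull (GlobalDivisorData.mk (S₂.op ⋙ arithDivisorFunctor F (Fbar F)) (S₂.op ⋙ unitsFunctor F (Fbar F))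
        (Functor.whiskerLeft S₂.op (divNatTrans F (Fbar F))) : GlobalDivisorData H₂).Φ (η.hom.app A) (E'.iso A.base (ModelFrobenioid.div φ))) ∧
      (ModelFrobenioid.data (GlobalDivisorData.mk (S₁.op ⋙ arithDivisorFunctor F (Fbar F)) (S₁.op ⋙ unitsFunctor F (Fbar F))
        (Functor.whiskerLeft S₁.op (divNatTrans F (Fbar F))) : GlobalDivisorData H₁).Φ (GlobalDivisorData.mk (S₁.op ⋙ arithDivisorFunctor F (Fbar F)) (S₁.op ⋙ unitsFunctor F (Fbar F))
        (Functor.whiskerLeft S₁.op (divNatTrans F (Fbar F))) : GlobalDivisorData H₁).B (GlobalDivisorData.mk (S₁.op ⋙ arithDivisorFunctor F (Fbar F)) (S₁.op ⋙ unitsFunctor F (Fbar F))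
        (Functor.whiskerLeft S₁.op (divNatTrans F (Fbar F))) : GlobalDivisorData H₁).div).Cor411ivRigid (ModelFrobenioid.data (GlobalDivisorData.mk (S₂.op ⋙ arithDivisorFunctor F (Fbar F)) (S₂.op ⋙ unitsFunctor F (Fbar F))
        (Functor.whiskerLeft S₂.op (divNatTrans F (Fbar F))) : GlobalDivisorData H₂).Φ (GlobalDivisorData.mk (S₂.op ⋙ arithDivisorFunctor F (Fbar F)) (S₂.op ⋙ unitsFunctor F (Fbar F))
        (Functor.whiskerLeft S₂.op (divNatTrans F (Fbar F))) : GlobalDivisorData H₂).B (GlobalDivisorData.mk (S₂.op ⋙ arithDivisorFunctor F (Fbar F)) (S₂.op ⋙ unitsFunctor F (Fbar F))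
        (Functor.whiskerLeft S₂.op (divNatTrans F (Fbar F))) : GlobalDivisorData H₂).div) Ψ ΨBase E' ∧
      IsRigidFunctor (Ψ.functor ⋙ (GlobalDivisorData.mk (S₂.op ⋙ arithDivisorFunctor F (Fbar F)) (S₂.op ⋙ unitsFunctor F (Fbar F))
        (Functor.whiskerLeft S₂.op (divNatTrans F (Fbar F))) : GlobalDivisorData H₂).modelBase) ∧ IsRigidFunctor ((GlobalDivisorData.mk (S₁.op ⋙ arithDivisorFunctor F (Fbar F)) (S₁.op ⋙ unitsFunctor F (Fbar F))
        (Functor.whiskerLeft S₁.op (divNatTrans F (Fbar F))) : GlobalDivisorData H₁).modelBase ⋙ ΨBase) := by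
  obtain ⟨ΨBase, E', η, hsq, hdeg, hdiv, hrigid, hslim⟩ :=
    FrdI.exists_cor411iv_data_ofFunctor (isFrobenioid_whisker F S₁) (isFrobenioid_whisker F S₂)
      (objectwise_isPerfFactorial_whisker F S₁) (objectwise_isPerfFactorial_whisker F S₂)
      (isRational_biratData_whisker F S₁) Ψ (cor411Setting_whisker F S₁ S₂ hZ₁ hZ₂ Ψ)
  obtain ⟨hr₁, hr₂⟩ := hslim (isSlim_baseCat_of_isSlimGroup H₁ hZ₁) (isSlim_baseCat_of_isSlimGroup H₂ hZ₂)
  exact ⟨ΨBase, E', η, hsq, hdeg, hdiv, hrigid, hr₁, hr₂⟩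

/-- **`HasUnder` for the base functors of two whiskered models**, modulo slimness (abc-iut-L6-t7's `hasUnder_modelBase`).
([IUTchI] Cor 5.3 (i) p.144) [claim: Mochizuki2012, status: disputed] -/
theorem hasUnder_modelBase_whisker (hZ₁ : IsSlimGroup H₁) (hZ₂ : IsSlimGroup H₂) :
    CatIsomorphism.HasUnder (GlobalDivisorData.mk (S₁.op ⋙ arithDivisorFunctor F (Fbar F)) (S₁.op ⋙ unitsFunctor F (Fbar F))
        (Functor.whiskerLeft S₁.op (divNatTrans F (Fbar F))) : GlobalDivisorData H₁).modelBase (GlobalDivisorData.mk (S₂.op ⋙ arithDivisorFunctor F (Fbar F)) (S₂.op ⋙ unitsFunctor F (Fbar F))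
        (Functor.whiskerLeft S₂.op (divNatTrans F (Fbar F))) : GlobalDivisorData H₂).modelBase := by
  haveI : Nonempty (BaseCat H₁) := (isGraphConnected_baseCat H₁).nonempty
  haveI : Nonempty (BaseCat H₂) := (isGraphConnected_baseCat H₂).nonempty
  exact hasUnder_modelBase _ _ (hypotheses_whisker F S₁) (hypotheses_whisker F S₂)
    (objectwise_isPerfFactorial_whisker F S₁) (objectwise_isPerfFactorial_whisker F S₂)
    (isSlim_baseCat_of_isSlimGroup H₁ hZ₁) (isSlim_baseCat_of_isSlimGroup H₂ hZ₂)
    (isNonDilatingOn_arithDivisorFunctor_comp S₁) (isNonDilatingOn_arithDivisorFunctor_comp S₂)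
    (not_isZeroMonoid_arithDivisorFunctor_comp S₁) (not_isZeroMonoid_arithDivisorFunctor_comp S₂)

/-- **`UnderUnique` for the base functors of two whiskered models**, modulo slimness. ([IUTchI] Cor 5.3 (i) p.144) [claim: Mochizuki2012, status: disputed] -/
theorem underUnique_modelBase_whisker (hZ₁ : IsSlimGroup H₁) (hZ₂ : IsSlimGroup H₂) :
    CatIsomorphism.UnderUnique (GlobalDivisorData.mk (S₁.op ⋙ arithDivisorFunctor F (Fbar F)) (S₁.op ⋙ unitsFunctor F (Fbar F))
        (Functor.whiskerLeft S₁.op (divNatTrans F (Fbar F))) : GlobalDivisorData H₁).modelBase (GlobalDivisorData.mk (S₂.op ⋙ arithDivisorFunctor F (Fbar F)) (S₂.op ⋙ unitsFunctor F (Fbar F))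
        (Functor.whiskerLeft S₂.op (divNatTrans F (Fbar F))) : GlobalDivisorData H₂).modelBase := by
  haveI : Nonempty (BaseCat H₁) := (isGraphConnected_baseCat H₁).nonempty
  haveI : Nonempty (BaseCat H₂) := (isGraphConnected_baseCat H₂).nonempty
  exact underUnique_modelBase _ _ (hypotheses_whisker F S₁) (hypotheses_whisker F S₂)
    (objectwise_isPerfFactorial_whisker F S₁) (objectwise_isPerfFactorial_whisker F S₂)
    (isSlim_baseCat_of_isSlimGroup H₁ hZ₁) (isSlim_baseCat_of_isSlimGroup H₂ hZ₂)
    (isNonDilatingOn_arithDivisorFunctor_comp S₁) (isNonDilatingOn_arithDivisorFunctor_comp S₂)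
    (not_isZeroMonoid_arithDivisorFunctor_comp S₁) (not_isZeroMonoid_arithDivisorFunctor_comp S₂)

end Two

end GlobalDivisorData

end Literature.IUT.HodgeTheaters

end
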